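import Mathlib
import Literature.AlgebraicGeometry.Resolution.AugmentationIdeal
import Literature.AlgebraicGeometry.Resolution.RegularQuotientIdeal
import Literature.AlgebraicGeometry.Resolution.StrictNormalCrossingsOpen
import Literature.AlgebraicGeometry.Resolution.RsopMonomialIdeals
import Summits.ResolutionOfSingularities.ResolutionOfSingularities.Theorems.WildQuotientsWildQuotientResolutionInvolutionKLTwice

/-!
# Involutions with `2` invertible on a regular local ring: the fixed locus is regular (card `mu2-strata-kl-twice`, H2)

(crux stmt-ResolutionOfSingularities-15640 `WildQuotients.WildQuotientResolution`, line `Sketch`,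
sector `|G| = p`; RUNG V5 of `L/w45c/CHAIN.md` v8.2, brick B7/`HP₂` (the `μ₂`-HIGH exit of `J₅`),
route = res-L1-w45c-idea-2's card `mu2-strata-kl-twice`; CHAIN v8.2 §0 «H2/H3 stub-3»; statement =
the def-free form of `Sketch-L1-idea-2.lean` v7 §Card H `InvolutionFixedLocusRegular` (H2), with the
regular-system-of-parameters clause in the cotangent form (linearly independent differentials).
[OURS · L1 W4.5c] — NOT a statement of any manuscript; replaces the role of no printed item.
Prover res-L1-w45c-stub-3.)

Setting: `(R, 𝔪)` a regular local ring, `ι : R ≃+* R` an involution (`ι (ι x) = x`) with `2 ∈ Rˣ`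
acting trivially on the residue field (`I_ι := augIdeal ι ≤ 𝔪`, i.e. the closed point is fixed);
`R₋ := {y | ι y = −y}`.

* `anti_mem_maximalIdeal` — anti-invariant elements lie in `𝔪`; `apply_mem_maximalIdeal` — `ι 𝔪 = 𝔪`.
* `sub_apply_mem_mul_of_mem_sq` — for `h ∈ 𝔪²`, `h − ι h ∈ 𝔪 · I_ι` (the anti-invariant part of
  `𝔪²` lies in `𝔪 · I_ι`).
* `exists_anti_generators_linearIndependent` — **`I_ι` is generated by anti-invariant elements
  `f₁, …, f_c ∈ 𝔪` with linearly independent differentials in `𝔪/𝔪²`** (select `f` among `R₋` with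
  `df` a basis of the span of `d R₋` (`exists_linearIndependent_of_subset_maximalIdeal`); then every
  anti-invariant `g` is `y + h` with `y ∈ (f)`, `h ∈ 𝔪²`, and anti-symmetrising,
  `g = ½(y − ιy) + ½(h − ιh) ∈ (f) + 𝔪 I_ι`; Nakayama).
* **`isRegularLocalRing_quotient_augIdeal`** (H2) — `R ⧸ I_ι` is a regular local ring (Matsumura
  14.2 via the tree's `isRegularLocalRing_quotient_span_image_of_linearIndependent_toCotangent`): the
  fixed locus `Fix ι = V(I_ι)` of a tame involution on a regular scheme is regular.
-/

-- single-problem summit: the doubled namespace component `ResolutionOfSingularities` is forced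
set_option linter.dupNamespace false

noncomputable section

namespace Summit.ResolutionOfSingularities.ResolutionOfSingularities.Theorems.WildQuotientResolution.InvolutionExit

open IsLocalRing
open Literature.AlgebraicGeometry.Resolution (augIdeal sub_mem_augIdeal)

variable {R : Type*} [CommRing R] [IsLocalRing R] (ι : R ≃+* R) (hι : ∀ x, ι (ι x) = x)

/-- If `ι` fixes the closed point (`I_ι ≤ 𝔪`) and `2` is invertible, anti-invariant elements lie
in `𝔪`. [folklore] -/
theorem anti_mem_maximalIdeal (h2 : IsUnit (2 : R)) (hm : augIdeal ι ≤ maximalIdeal R) {y : R}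
    (hy : ι y = -y) : y ∈ maximalIdeal R := by
  obtain ⟨u, hu⟩ := h2.exists_left_inv
  have h1 : ι y - y ∈ maximalIdeal R := hm (sub_mem_augIdeal ι y)
  rw [hy, show (-y - y : R) = -(2 * y) by ring] at h1
  have h3 : u * (2 * y) ∈ maximalIdeal R := Ideal.mul_mem_left _ _ ((neg_mem_iff).mp h1)
  rwa [← mul_assoc, hu, one_mul] at h3

/-- If `ι` fixes the closed point, `ι 𝔪 ⊆ 𝔪`. [folklore] -/
theorem apply_mem_maximalIdeal (hm : augIdeal ι ≤ maximalIdeal R) {x : R}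
    (hx : x ∈ maximalIdeal R) : ι x ∈ maximalIdeal R := by
  have h : ι x = x + (ι x - x) := by ring
  rw [h]
  exact add_mem hx (hm (sub_mem_augIdeal ι x))

/-- For `h ∈ 𝔪²`, `h − ι h ∈ 𝔪 · I_ι` (`ι` fixing the closed point). [folklore] -/
theorem sub_apply_mem_mul_of_mem_sq (hm : augIdeal ι ≤ maximalIdeal R) {h : R}
    (hh : h ∈ maximalIdeal R ^ 2) : h - ι h ∈ maximalIdeal R * augIdeal ι := by
  rw [pow_two] at hh
  refine Submodule.mul_induction_on hh ?_ ?_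
  · intro a ha b hb
    have e : a * b - ι (a * b) = a * (b - ι b) + ι b * (a - ι a) := by rw [map_mul]; ring
    rw [e]
    refine add_mem (Ideal.mul_mem_mul ha ?_) (Ideal.mul_mem_mul (apply_mem_maximalIdeal ι hm hb) ?_)
    · have h1 : b - ι b = -(ι b - b) := by ring
      rw [h1]; exact neg_mem (sub_mem_augIdeal ι b)
    · have h1 : a - ι a = -(ι a - a) := by ring
      rw [h1]; exact neg_mem (sub_mem_augIdeal ι a)
  · intro x y hx hy
    have e : x + y - ι (x + y) = (x - ι x) + (y - ι y) := by rw [map_add]; ring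
    rw [e]; exact add_mem hx hy

omit [IsLocalRing R] in
/-- An ideal generated by anti-invariant elements is `ι`-stable. [folklore] -/
theorem apply_mem_span_of_anti {s : Set R} (hs : ∀ y ∈ s, ι y = -y) {x : R}
    (hx : x ∈ Ideal.span s) : ι x ∈ Ideal.span s := by
  induction hx using Submodule.span_induction with
  | mem y hy => rw [hs y hy]; exact neg_mem (Ideal.subset_span hy)
  | zero => rw [map_zero]; exact zero_mem _
  | add x y _ _ hx hy => rw [map_add]; exact add_mem hx hy
  | smul a x _ hx => rw [smul_eq_mul, map_mul]; exact Ideal.mul_mem_left _ _ hx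

end Summit.ResolutionOfSingularities.ResolutionOfSingularities.Theorems.WildQuotientResolution.InvolutionExit

namespace Summit.ResolutionOfSingularities.ResolutionOfSingularities.Theorems.WildQuotientResolution.InvolutionExit

open IsLocalRing
open Literature.AlgebraicGeometry.Resolution

variable {R : Type} [CommRing R] [IsRegularLocalRing R] (ι : R ≃+* R) (hι : ∀ x, ι (ι x) = x)

include hι in
/-- **`I_ι` is generated by anti-invariant elements with linearly independent differentials**
(`(R, 𝔪)` regular local, `ι` an involution fixing the closed point, `2 ∈ Rˣ`): there are
anti-invariant `f₁, …, f_c ∈ 𝔪` with `I_ι = (f₁, …, f_c)` whose images in `𝔪/𝔪²` are linearly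
independent — part of a regular system of parameters. [OURS · L1 W4.5c, card `mu2-strata-kl-twice`
H2] [folklore] -/
theorem exists_anti_generators_linearIndependent (h2 : IsUnit (2 : R))
    (hm : augIdeal ι ≤ maximalIdeal R) :
    ∃ (c : ℕ) (f : Fin c → R) (hf : ∀ i, f i ∈ maximalIdeal R), (∀ i, ι (f i) = -f i) ∧
      Ideal.span (Set.range f) = augIdeal ι ∧
      LinearIndependent (ResidueField R) fun i => (maximalIdeal R).toCotangent ⟨f i, hf i⟩ := by
  classical
  obtain ⟨u, hu⟩ := h2.exists_left_inv
  set m := maximalIdeal R with hmdef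
  set G : Set R := {y : R | ι y = -y} with hG
  have hGm : G ⊆ m := fun y hy => anti_mem_maximalIdeal ι h2 hm hy
  obtain ⟨c, f, hfG, hli, hspan⟩ := exists_linearIndependent_of_subset_maximalIdeal G hGm
  have hf : ∀ i, f i ∈ m := fun i => hGm (hfG i)
  have hfanti : ∀ i, ι (f i) = -f i := fun i => hfG i
  set Y : Ideal R := Ideal.span (Set.range f) with hY
  have hIG : augIdeal ι = Ideal.span G := augIdeal_eq_span_anti ι hι h2
  have hYI : Y ≤ augIdeal ι := by
    rw [hIG]
    exact Ideal.span_mono (by rintro _ ⟨i, rfl⟩; exact hfG i)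
  -- every anti-invariant `g` lies in `Y + 𝔪²`
  have hstep : ∀ g ∈ G, ∃ y ∈ Y, g - y ∈ m ^ 2 := by
    intro g hg
    let f' : Fin c → m := fun i => ⟨f i, hf i⟩
    have hdg : m.toCotangent ⟨g, hGm hg⟩ ∈
        Submodule.span (ResidueField R) (Set.range fun i => m.toCotangent (f' i)) := by
      rw [hspan]
      exact Submodule.subset_span ⟨⟨g, hg⟩, rfl⟩
    have hdgR : m.toCotangent ⟨g, hGm hg⟩ ∈
        Submodule.span R (Set.range fun i => m.toCotangent (f' i)) := by
      rw [← Submodule.restrictScalars_span R (ResidueField R) Ideal.Quotient.mk_surjective]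
      exact hdg
    rw [Set.range_comp' , ← Submodule.map_span] at hdgR
    obtain ⟨y, hy, hyg⟩ := hdgR
    refine ⟨(y : R), ?_, ?_⟩
    · have h1 : (m.subtype) y ∈ (Submodule.span R (Set.range f')).map m.subtype :=
        Submodule.mem_map_of_mem hy
      rw [Submodule.map_span, ← Set.range_comp] at h1
      exact h1
    · exact (Ideal.toCotangent_eq m).mp hyg.symm
  -- hence `I ≤ Y ⊔ 𝔪 • I`
  have hle : augIdeal ι ≤ Y ⊔ m • augIdeal ι := by
    rw [hIG]
    refine Ideal.span_le.mpr fun g hg => ?_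
    obtain ⟨y, hyY, hgy⟩ := hstep g hg
    have hιy : ι y ∈ Y := apply_mem_span_of_anti ι (by rintro _ ⟨i, rfl⟩; exact hfanti i) hyY
    -- anti-symmetrise: `g = u (y − ι y) + u ((g − y) − ι (g − y))`
    have e : g = u * (y - ι y) + u * ((g - y) - ι (g - y)) := by
      have hg' : ι g = -g := hg
      have h2g : g = u * (2 * g) := by rw [← mul_assoc, hu, one_mul]
      rw [map_sub, hg']
      linear_combination h2g
    rw [SetLike.mem_coe, e]
    refine add_mem (Ideal.mem_sup_left (Ideal.mul_mem_left _ _ (sub_mem hyY hιy)))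
      (Ideal.mem_sup_right (Ideal.mul_mem_left _ _ ?_))
    rw [smul_eq_mul, ← hIG]
    exact sub_apply_mem_mul_of_mem_sq ι hm hgy
  have hfg : (augIdeal ι).FG := (IsNoetherian.noetherian (augIdeal ι))
  have hIY : augIdeal ι ≤ Y :=
    Submodule.le_of_le_smul_of_le_jacobson_bot hfg
      (IsLocalRing.jacobson_eq_maximalIdeal ⊥ bot_ne_top).ge hle
  exact ⟨c, f, hf, hfanti, le_antisymm hYI hIY, hli⟩

include hι in
/-- **H2 — the fixed locus of a tame involution on a regular local ring is regular**: for an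
involution `ι` of a regular local ring `(R, 𝔪)` fixing the closed point (`I_ι ≤ 𝔪`), with `2`
invertible, `R ⧸ I_ι` is a regular local ring. [OURS · L1 W4.5c, card `mu2-strata-kl-twice` H2]
[folklore] -/
theorem isRegularLocalRing_quotient_augIdeal (h2 : IsUnit (2 : R))
    (hm : augIdeal ι ≤ maximalIdeal R) : IsRegularLocalRing (R ⧸ augIdeal ι) := by
  obtain ⟨c, f, hf, -, hspan, hli⟩ := exists_anti_generators_linearIndependent ι hι h2 hm
  have h := isRegularLocalRing_quotient_span_image_of_linearIndependent_toCotangent f hf hli Set.univ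
  rw [Set.image_univ, hspan] at h
  exact h

include hι in
/-- The anti-invariant generators of `I_ι` are PART OF A REGULAR SYSTEM OF PARAMETERS
(`IsRsopPart`). [OURS · L1 W4.5c, card `mu2-strata-kl-twice` H2] [folklore] -/
theorem exists_anti_isRsopPart (h2 : IsUnit (2 : R)) (hm : augIdeal ι ≤ maximalIdeal R) :
    ∃ (c : ℕ) (f : Fin c → R), (∀ i, ι (f i) = -f i) ∧ Ideal.span (Set.range f) = augIdeal ι ∧
      IsRsopPart f := by
  obtain ⟨c, f, hf, hanti, hspan, hli⟩ := exists_anti_generators_linearIndependent ι hι h2 hm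
  obtain ⟨e, y, hdim, hsp⟩ := exists_extend_to_rsop f hf
    ((linearIndependent_toCotangent_iff_forall_mem f hf).mp hli)
  exact ⟨c, f, hanti, hspan, ‹IsRegularLocalRing R›, e, y, hdim, hsp⟩

include hι in
/-- **H2, the Sketch statement verbatim** (`InvolutionFixedLocusRegular` of
`Sketch-L1-idea-2.lean` §Card H, def-free with the involution spelt `∀ x, ι (ι x) = x`):
`R ⧸ I_ι` is regular local and `I_ι` is generated by a finite set `s` of anti-invariant elements with
`#s + dim R/I_ι = dim R`. [OURS · L1 W4.5c, card `mu2-strata-kl-twice` H2] [folklore] -/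
theorem isRegularLocalRing_quotient_augIdeal_and_exists_finset (h2 : IsUnit (2 : R))
    (hm : augIdeal ι ≤ maximalIdeal R) :
    IsRegularLocalRing (R ⧸ augIdeal ι) ∧
      ∃ s : Finset R, (∀ y ∈ s, ι y = -y) ∧ Ideal.span (s : Set R) = augIdeal ι ∧
        (s.card : WithBot ℕ∞) + ringKrullDim (R ⧸ augIdeal ι) = ringKrullDim R := by
  classical
  refine ⟨isRegularLocalRing_quotient_augIdeal ι hι h2 hm, ?_⟩
  obtain ⟨c, f, hanti, hspan, hrsop⟩ := exists_anti_isRsopPart ι hι h2 hm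
  refine ⟨Finset.univ.image f, ?_, ?_, ?_⟩
  · intro y hy
    obtain ⟨i, -, rfl⟩ := Finset.mem_image.mp hy
    exact hanti i
  · rw [Finset.coe_image, Finset.coe_univ, Set.image_univ, hspan]
  · rw [Finset.card_image_of_injective _ hrsop.injective, Finset.card_univ, Fintype.card_fin,
      ← hspan, add_comm]
    exact hrsop.ringKrullDim_quotient_add

end Summit.ResolutionOfSingularities.ResolutionOfSingularities.Theorems.WildQuotientResolution.InvolutionExit

end
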